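import Summits.AtomisticToContinuum.Crystallization.Theorems.FrustratedLawDichotomyStrainedPatchHomEntryLeafHTA2QCentredRot
import Summits.AtomisticToContinuum.Crystallization.Theorems.FrustratedLawDichotomyStrainedPatchHomEntryLeafHTConsumerContainment

/-!
# The slab leaf with EXISTENTIALLY BOUND payloads: ONE production verdict `entryLeafOKHT4A2QQDCRE μ` for the whole hcp-half tree, no payload functions
# (27623 `(H) HomFloor (1/625)`, hcp half; hand-1 g35; critic rows 1327/1329 priority (3) «production payload functions P/Qv/Gf/Jf/Qf/T for the v3 consumer»)

decomp-a2c hand-1 g35 (crux `AperiodicFrustratedLawGap`, stmt-AtomisticToContinuum-27623).  The consumer of record v3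
(`…HTA2QCentredRot.homFloor_625_of_entryTrees6RBKP_HT4A2QQDCRX μ P Qv Gf Jf Qf T`) reads the per-cell payloads (certificate, component bounds, near bound, tilt,
rotation, inner sub-tree) off six payload FUNCTIONS that are part of the leaf verdict — so the verdict, and with it every leaf fact, changes whenever the payload
table grows, and a table look-up keyed on the 12 box integers costs the kernel `O(cells)` comparisons per leaf.  Since `…HomCertTree.treeOK_sound` only ever uses a
leaf verdict through its soundness, the payloads can be bound EXISTENTIALLY inside the verdict instead:

* ★ `entryLeafOKHT4A2QQDCRE μ c w := decide (∃ q p Q Gn J t, entryLeafOKHT4A2QQDCR μ q p Q Gn J t c w) ∨ entryLeafOKHCCX μ c w` — some payload `(q, p, Q, Gn, J, t)`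
  passes the affine-reference slab leaf, else the union verdict of record (classical `decide`; the kernel never evaluates it — a production
  leaf fact is the explicit-payload kernel fact of the cell, e.g. `…HTA2QCellXA3.entryLeafOKHT4A2QQDCR_XA2`, lifted by ★ `entryLeafOKHT4A2QQDCRE_of_cert`, and the
  interior nodes are glued by the verdict-agnostic literal ∃-tree currency `…HomEntryTreeShard.exists_tree_split_lit` exactly as in `…CertHcpHPilotSh5Glue01`);
* `entryLeafOKHT4A2QQDCRE_of_HCCX` (the union verdict of record is a disjunct), `entryLeafOKHT4A2QQDCRE_of_X` + ★ `treeOK_HT4A2QQDCRE_of_X` (every tree accepted by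
  the v3 functions-consumer is accepted: CONTAINMENT, nothing is lost), ★★ `entryLeafOKHT4A2QQDCRE_sound`, ★★ `hcpHalf_of_entryTreeHT4A2QQDCRE`,
  ★★★ `homFloor_625_of_entryTrees6RBKP_HT4A2QQDCRE` — `(H) HomFloor (1/625)` from the fcc ∃-tree and ONE hcp ∃-tree over `entryLeafOKHT4A2QQDCRE muRec`;
* leaf currency: ★ `exists_tree_HT4A2QQDCRE_of_cert` / `exists_tree_HT4A2QQDCRE_of_HCCX` (a certified cell IS a one-leaf ∃-tree).

Definitions + soundness / bookkeeping; 0 sorry; standard axioms; no instances / notation / `#eval`.  `--supports stmt-AtomisticToContinuum-27623`.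
-/

noncomputable section

namespace Summit.AtomisticToContinuum.Crystallization.Theorems.FrustratedLawDichotomyStrainedPatchHomEntryLeafHT

open scoped BigOperators RealInnerProductSpace
open Literature.Analysis.ValidatedNumerics.Numerics
open Summit.AtomisticToContinuum.Crystallization.Theorems.ChargedEnergyGapNegative (E3)
open Summit.AtomisticToContinuum.Crystallization.Theorems.FrustratedLawDichotomySchurCut (effPot w₄₅ ω₄)
open Summit.AtomisticToContinuum.Crystallization.Theorems.FrustratedLawDichotomyAveragingRuleTightFree (TightNearCap BadNearCap)
open Summit.AtomisticToContinuum.Crystallization.Theorems.FrustratedLawDichotomyExemptAbsorption (ExemptNear)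
open Summit.AtomisticToContinuum.Crystallization.Theorems.FrustratedLawDichotomyStrainedPatchHomSplit (ExRec latPt hexFrame hcpShift HomFloor)
open Summit.AtomisticToContinuum.Crystallization.Theorems.FrustratedLawDichotomyStrainedPatchHomCurvLeafHCC (entryLeafOKHCCX entryLeafOKHCCX_sound)
open Summit.AtomisticToContinuum.Crystallization.Theorems.FrustratedLawDichotomyStrainedPatchHomPrunedPolar (homFloor_of_prunedBoxSums_selfAdjoint)
open Summit.AtomisticToContinuum.Crystallization.Theorems.FrustratedLawDichotomyStrainedPatchHomCertTree (CertTree treeOK)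
open Summit.AtomisticToContinuum.Crystallization.Theorems.FrustratedLawDichotomyStrainedPatchHomEntryGram (rootC rootW)
open Summit.AtomisticToContinuum.Crystallization.Theorems.FrustratedLawDichotomyStrainedPatchHomEntryGramHcp (rootCH rootWH)
open Summit.AtomisticToContinuum.Crystallization.Theorems.FrustratedLawDichotomyStrainedPatchHomEntryTable (muRec muRec_ok)
open Summit.AtomisticToContinuum.Crystallization.Theorems.FrustratedLawDichotomyStrainedPatchHomEntryTableP (entryLeafOK6RBKP)
open Summit.AtomisticToContinuum.Crystallization.Theorems.FrustratedLawDichotomyStrainedPatchHomEntryTreeCert (fccHalf_of_entryTree6RBKP)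
open Summit.AtomisticToContinuum.Crystallization.Theorems.FrustratedLawDichotomyStrainedPatchHomEntryFlipHcp (HcpDich hcpHalf_of_entryTreeShuf)

/-- ★ **THE PRODUCTION LEAF VERDICT WITH EXISTENTIAL PAYLOADS**: some payload passes the affine-reference slab leaf, else the union verdict of record
`entryLeafOKHCCX μ` (classical `decide`; never evaluated by the kernel — leaf facts enter through `entryLeafOKHT4A2QQDCRE_of_cert` / `_of_HCCX`). -/
def entryLeafOKHT4A2QQDCRE (μ : ℤ) (c w : (Fin 3 × Fin 3) ⊕ Fin 3 → ℤ) : Bool :=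
  @decide (∃ (q : Fin 4 → ℤ) (p : HTCert) (Q : Fin 3 → ℤ) (Gn : ℤ) (J : Fin 3 → Fin 3 × Fin 3 → ℤ) (t : CertTree ((Fin 3 × Fin 3) ⊕ Fin 3)),
      entryLeafOKHT4A2QQDCR μ q p Q Gn J t c w = true) (Classical.propDecidable _) || entryLeafOKHCCX μ c w

/-- ★ A cell certified with EXPLICIT payloads passes the existential verdict. [formal bookkeeping] -/
theorem entryLeafOKHT4A2QQDCRE_of_cert {μ : ℤ} {q : Fin 4 → ℤ} {p : HTCert} {Q : Fin 3 → ℤ} {Gn : ℤ} {J : Fin 3 → Fin 3 × Fin 3 → ℤ}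
    {t : CertTree ((Fin 3 × Fin 3) ⊕ Fin 3)} {c w : (Fin 3 × Fin 3) ⊕ Fin 3 → ℤ} (h : entryLeafOKHT4A2QQDCR μ q p Q Gn J t c w = true) :
    entryLeafOKHT4A2QQDCRE μ c w = true := by
  unfold entryLeafOKHT4A2QQDCRE
  rw [Bool.or_eq_true]
  exact Or.inl (@decide_eq_true _ (Classical.propDecidable _) ⟨q, p, Q, Gn, J, t, h⟩)

/-- A cell passing the union verdict of record passes the existential verdict. [formal bookkeeping] -/
theorem entryLeafOKHT4A2QQDCRE_of_HCCX {μ : ℤ} {c w : (Fin 3 × Fin 3) ⊕ Fin 3 → ℤ} (h : entryLeafOKHCCX μ c w = true) :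
    entryLeafOKHT4A2QQDCRE μ c w = true := by
  unfold entryLeafOKHT4A2QQDCRE
  rw [Bool.or_eq_true]
  exact Or.inr h

/-- CONTAINMENT at the leaf: the functions-verdict `entryLeafOKHT4A2QQDCRX μ P Qv Gf Jf Qf T` (any payload functions) implies the existential verdict.
[formal bookkeeping] -/
theorem entryLeafOKHT4A2QQDCRE_of_X {μ : ℤ} {P : ((Fin 3 × Fin 3) ⊕ Fin 3 → ℤ) → ((Fin 3 × Fin 3) ⊕ Fin 3 → ℤ) → HTCert}
    {Qv : ((Fin 3 × Fin 3) ⊕ Fin 3 → ℤ) → ((Fin 3 × Fin 3) ⊕ Fin 3 → ℤ) → (Fin 3 → ℤ)} {Gf : ((Fin 3 × Fin 3) ⊕ Fin 3 → ℤ) → ((Fin 3 × Fin 3) ⊕ Fin 3 → ℤ) → ℤ}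
    {Jf : ((Fin 3 × Fin 3) ⊕ Fin 3 → ℤ) → ((Fin 3 × Fin 3) ⊕ Fin 3 → ℤ) → (Fin 3 → Fin 3 × Fin 3 → ℤ)}
    {Qf : ((Fin 3 × Fin 3) ⊕ Fin 3 → ℤ) → ((Fin 3 × Fin 3) ⊕ Fin 3 → ℤ) → (Fin 4 → ℤ)}
    {T : ((Fin 3 × Fin 3) ⊕ Fin 3 → ℤ) → ((Fin 3 × Fin 3) ⊕ Fin 3 → ℤ) → CertTree ((Fin 3 × Fin 3) ⊕ Fin 3)}
    {c w : (Fin 3 × Fin 3) ⊕ Fin 3 → ℤ} (h : entryLeafOKHT4A2QQDCRX μ P Qv Gf Jf Qf T c w = true) : entryLeafOKHT4A2QQDCRE μ c w = true := by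
  simp only [entryLeafOKHT4A2QQDCRX, Bool.or_eq_true] at h
  rcases h with h | h
  · exact entryLeafOKHT4A2QQDCRE_of_cert h
  · exact entryLeafOKHT4A2QQDCRE_of_HCCX h

/-- ★ CONTAINMENT for whole certificate trees: a tree accepted by the v3 functions-consumer is accepted by the existential verdict. [formal bookkeeping] -/
theorem treeOK_HT4A2QQDCRE_of_X {μ : ℤ} {P : ((Fin 3 × Fin 3) ⊕ Fin 3 → ℤ) → ((Fin 3 × Fin 3) ⊕ Fin 3 → ℤ) → HTCert}
    {Qv : ((Fin 3 × Fin 3) ⊕ Fin 3 → ℤ) → ((Fin 3 × Fin 3) ⊕ Fin 3 → ℤ) → (Fin 3 → ℤ)} {Gf : ((Fin 3 × Fin 3) ⊕ Fin 3 → ℤ) → ((Fin 3 × Fin 3) ⊕ Fin 3 → ℤ) → ℤ}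
    {Jf : ((Fin 3 × Fin 3) ⊕ Fin 3 → ℤ) → ((Fin 3 × Fin 3) ⊕ Fin 3 → ℤ) → (Fin 3 → Fin 3 × Fin 3 → ℤ)}
    {Qf : ((Fin 3 × Fin 3) ⊕ Fin 3 → ℤ) → ((Fin 3 × Fin 3) ⊕ Fin 3 → ℤ) → (Fin 4 → ℤ)}
    {T : ((Fin 3 × Fin 3) ⊕ Fin 3 → ℤ) → ((Fin 3 × Fin 3) ⊕ Fin 3 → ℤ) → CertTree ((Fin 3 × Fin 3) ⊕ Fin 3)}
    {t : CertTree ((Fin 3 × Fin 3) ⊕ Fin 3)} {c w : (Fin 3 × Fin 3) ⊕ Fin 3 → ℤ} (h : treeOK (entryLeafOKHT4A2QQDCRX μ P Qv Gf Jf Qf T) t c w = true) :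
    treeOK (entryLeafOKHT4A2QQDCRE μ) t c w = true :=
  treeOK_mono (fun _ _ h' => entryLeafOKHT4A2QQDCRE_of_X h') t c w h

/-- ★★ Soundness of `entryLeafOKHT4A2QQDCRE` in the hver shape. [folklore chaining: a classical witness of the existential feeds
`entryLeafOKHT4A2QQDCR_sound`; the other disjunct is `entryLeafOKHCCX_sound`] -/
theorem entryLeafOKHT4A2QQDCRE_sound {μ : ℤ} {c w : (Fin 3 × Fin 3) ⊕ Fin 3 → ℤ} (h : entryLeafOKHT4A2QQDCRE μ c w = true) (U : E3 →L[ℝ] E3) (ξ : E3)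
    (hsa : ∀ v v' : E3, ⟪U v, v'⟫ = ⟪v, U v'⟫) (hU : ‖U - 1‖ ≤ 1 / 4)
    (hbox : ∀ ab : Fin 3 × Fin 3, |(U (EuclideanSpace.single ab.2 (1 : ℝ))) ab.1 - (c (Sum.inl ab) : ℝ) / SC| ≤ (w (Sum.inl ab) : ℝ) / SC)
    (hξ : ∀ i : Fin 3, |ξ i - (c (Sum.inr i) : ℝ) / SC| ≤ (w (Sum.inr i) : ℝ) / SC) (h0 : 0 ≤ ξ 0) (h2 : 0 ≤ ξ 2) :
    (∀ (M : ℕ) (z : Fin M → E3) (cc : Fin M), Function.Injective z →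
        Set.range z = {x : E3 | dist x (z cc) ≤ 133 / 10 ∧ ∃ a : Fin 3 → ℤ,
          x = z cc + latPt U hexFrame a ∨ x = z cc + latPt U hexFrame a + U (hcpShift + ξ)} →
        TightNearCap (9 / 5) (3 / 2) z cc ∨ ExemptNear (9 / 5) ExRec z cc ∨ BadNearCap (9 / 5) (3 / 2) z cc) ∨
      (μ : ℝ) / SC ≤ ∑ b ∈ (Fintype.piFinset fun _ : Fin 3 => Finset.Icc (-7 : ℤ) 7).filter (fun b => b ≠ 0), effPot w₄₅ ω₄ (3 / 400) ‖latPt U hexFrame b‖ +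
        ∑ b ∈ (Fintype.piFinset fun _ : Fin 3 => Finset.Icc (-7 : ℤ) 7), effPot w₄₅ ω₄ (3 / 400) ‖latPt U hexFrame b + U (hcpShift + ξ)‖ := by
  unfold entryLeafOKHT4A2QQDCRE at h
  rw [Bool.or_eq_true] at h
  rcases h with h | h
  · obtain ⟨q, p, Q, Gn, J, t, ht⟩ := @of_decide_eq_true _ (Classical.propDecidable _) h
    exact entryLeafOKHT4A2QQDCR_sound ht U ξ hsa hU hbox hξ h0 h2
  · exact entryLeafOKHCCX_sound h U ξ hsa hU hbox hξ h0 h2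

/-- ★★ The hcp half from ONE certificate tree over `entryLeafOKHT4A2QQDCRE μ`. [folklore chaining] -/
theorem hcpHalf_of_entryTreeHT4A2QQDCRE {m : ℝ} {μ : ℤ} (hμ : 2 * (m + (-(7175 / 10000) + 3 / 400)) * SC ≤ μ)
    {t : CertTree ((Fin 3 × Fin 3) ⊕ Fin 3)} (h : treeOK (entryLeafOKHT4A2QQDCRE μ) t rootCH rootWH = true) :
    ∀ (U : E3 →L[ℝ] E3) (ξ : E3), (∀ v w : E3, inner ℝ (U v) w = inner ℝ v (U w)) → (∀ w : E3, 0 ≤ inner ℝ w (U w)) →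
      ‖U - 1‖ ≤ 1 / 4 → ‖ξ‖ ≤ 1 / 4 → HcpDich m U ξ :=
  hcpHalf_of_entryTreeShuf hμ (entryLeafOKHT4A2QQDCRE μ) (fun _ _ hv U ξ hsa hU hbox hξ h0 h2 => entryLeafOKHT4A2QQDCRE_sound hv U ξ hsa hU hbox hξ h0 h2) h

/-- ★★★ **`(H) HomFloor (1/625)` FROM THE fcc ∃-TREE AND ONE hcp ∃-TREE OVER THE EXISTENTIAL-PAYLOAD VERDICT** (`μ = muRec`) — the production consumer: every
leaf is either an explicit-payload slab-leaf kernel fact of its cell or the union verdict of record, glued by the literal ∃-tree currency. [folklore] -/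
theorem homFloor_625_of_entryTrees6RBKP_HT4A2QQDCRE
    (hF : ∃ t : CertTree (Fin 3 × Fin 3), treeOK (entryLeafOK6RBKP muRec) t rootC rootW = true)
    (hH : ∃ t : CertTree ((Fin 3 × Fin 3) ⊕ Fin 3), treeOK (entryLeafOKHT4A2QQDCRE muRec) t rootCH rootWH = true) : HomFloor (1 / 625) := by
  obtain ⟨tF, htF⟩ := hF
  obtain ⟨tH, htH⟩ := hH
  exact homFloor_of_prunedBoxSums_selfAdjoint (fccHalf_of_entryTree6RBKP muRec_ok htF) (hcpHalf_of_entryTreeHT4A2QQDCRE muRec_ok htH)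

/-- ★★★ CONTAINMENT at the consumer: the `hH` hypothesis of the v3 functions-consumer `homFloor_625_of_entryTrees6RBKP_HT4A2QQDCRX` (any payload functions) yields
the `hH` hypothesis of the existential-payload consumer. [formal bookkeeping] -/
theorem exists_treeOK_HT4A2QQDCRE_of_X {μ : ℤ} {P : ((Fin 3 × Fin 3) ⊕ Fin 3 → ℤ) → ((Fin 3 × Fin 3) ⊕ Fin 3 → ℤ) → HTCert}
    {Qv : ((Fin 3 × Fin 3) ⊕ Fin 3 → ℤ) → ((Fin 3 × Fin 3) ⊕ Fin 3 → ℤ) → (Fin 3 → ℤ)} {Gf : ((Fin 3 × Fin 3) ⊕ Fin 3 → ℤ) → ((Fin 3 × Fin 3) ⊕ Fin 3 → ℤ) → ℤ}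
    {Jf : ((Fin 3 × Fin 3) ⊕ Fin 3 → ℤ) → ((Fin 3 × Fin 3) ⊕ Fin 3 → ℤ) → (Fin 3 → Fin 3 × Fin 3 → ℤ)}
    {Qf : ((Fin 3 × Fin 3) ⊕ Fin 3 → ℤ) → ((Fin 3 × Fin 3) ⊕ Fin 3 → ℤ) → (Fin 4 → ℤ)}
    {T : ((Fin 3 × Fin 3) ⊕ Fin 3 → ℤ) → ((Fin 3 × Fin 3) ⊕ Fin 3 → ℤ) → CertTree ((Fin 3 × Fin 3) ⊕ Fin 3)} {c w : (Fin 3 × Fin 3) ⊕ Fin 3 → ℤ}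
    (hH : ∃ t : CertTree ((Fin 3 × Fin 3) ⊕ Fin 3), treeOK (entryLeafOKHT4A2QQDCRX μ P Qv Gf Jf Qf T) t c w = true) :
    ∃ t : CertTree ((Fin 3 × Fin 3) ⊕ Fin 3), treeOK (entryLeafOKHT4A2QQDCRE μ) t c w = true := by
  obtain ⟨t, ht⟩ := hH
  exact ⟨t, treeOK_HT4A2QQDCRE_of_X ht⟩

/-- ★ LEAF CURRENCY: a cell certified with explicit payloads IS a one-leaf ∃-tree over the existential verdict (the input of `exists_tree_split_lit` gluing).
[formal bookkeeping] -/
theorem exists_tree_HT4A2QQDCRE_of_cert {μ : ℤ} {q : Fin 4 → ℤ} {p : HTCert} {Q : Fin 3 → ℤ} {Gn : ℤ} {J : Fin 3 → Fin 3 × Fin 3 → ℤ}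
    {t : CertTree ((Fin 3 × Fin 3) ⊕ Fin 3)} {c w : (Fin 3 × Fin 3) ⊕ Fin 3 → ℤ} (h : entryLeafOKHT4A2QQDCR μ q p Q Gn J t c w = true) :
    ∃ t' : CertTree ((Fin 3 × Fin 3) ⊕ Fin 3), treeOK (entryLeafOKHT4A2QQDCRE μ) t' c w = true :=
  ⟨.leaf, entryLeafOKHT4A2QQDCRE_of_cert h⟩

/-- LEAF CURRENCY for the union verdict of record. [formal bookkeeping] -/
theorem exists_tree_HT4A2QQDCRE_of_HCCX {μ : ℤ} {c w : (Fin 3 × Fin 3) ⊕ Fin 3 → ℤ} (h : entryLeafOKHCCX μ c w = true) :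
    ∃ t' : CertTree ((Fin 3 × Fin 3) ⊕ Fin 3), treeOK (entryLeafOKHT4A2QQDCRE μ) t' c w = true :=
  ⟨.leaf, entryLeafOKHT4A2QQDCRE_of_HCCX h⟩

end Summit.AtomisticToContinuum.Crystallization.Theorems.FrustratedLawDichotomyStrainedPatchHomEntryLeafHT

end
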